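import Summits.QuantumFields.YangMills.Theorems.UnitScaleTiltProp7TorusCellRepr
import Summits.QuantumFields.YangMills.Theorems.UnitScaleTiltProp7SPrintDefs
import Literature.MathematicalPhysics.QuantumFieldTheory.Balaban1983to89.T3SectALandauChart
import Literature.MathematicalPhysics.QuantumFieldTheory.Balaban1983to89.B11Thm1LevelZero
import Literature.MathematicalPhysics.QuantumFieldTheory.Balaban1983to89.B8Eq143PlaqExpansion
import HarnessLib

/-!
# Route `UnitScaleTilt`, crux K1 «MinimiserStabilityRegPr» (stmt-QuantumFields-19200), route-R E′, architecture (A′) «HCOW-VIA-Σ» (★★OWNER RULING g28-№13), package P-A4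
# «CRUDE SLICE ON PRINT'S SLICE», CURVED — FILE (b-T)₂a «TORUS BLOCK FIBRES» (bookkeeping half of (b-T)₂ «THE COMPETITOR'S ENERGY AT THE TORUS MEMBER»): the bubble competitor built on the `ℤ^d` pullback (px11 g5 (b-ℤ):
# `G z = φ(z)·R(σ_z)⁻¹ ν(block z)`, `σ_z` the comb transport from the block corner, `ν` the Neumann-corrected block datum) read on the torus as `fC := G ∘ ρ` (`ρ` the cell
# representative of ✓ `Prop7TorusCellRepr`) has FROBENIUS energy `Σ_b Σ_jk |(D^η_V fC)(b)_jk|² ≤ C·Σ_x Σ_jk |f(x)_jk|²` with `C = η⁻²·4·(dA₁ + (2dℓκ₀)²·dB₁)·μ₀²·ℓ^{−d}` —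
# ✓ `Prop7BlockCompetitorEnergy.competitor_energy_le_of_datumRow` instantiated at `X := Site`, `E := PBond`, `W := M₂(ℂ)` (operator norm), conjugation transports, from FIVE displayed
# rows: the bubble rows (sign ∕ boundary layer ∕ gradient `A₁` ∕ square `B₁` per block, ✓ `Prop7BubbleOnBlocks`), the comb-gauge row (κ) (px11 ✓ F2b), and the datum row (px11 (b-ℤ) (N))

Cell `ym3-torus`, width seat `ym3-torus-px19` (gen 5); pens of record px12 g5 02:39:52Z ∕ px11 g5 03:15:50Z ∕ px12 g5 03:00:34Z: (b-T) = px19 (this file), (b-ℤ) = px11 (`G`, `ν`,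
`QprimeIter_competitor_eq`, `norm_datum_le`), (a) + F3 = px12 (`div_sq_le_of_combBernsteinRow`: its `hF1` = (a) ∘ [(b-ℤ) coset identity] ∘ [this file's energy]).  The letters `G`, `ν`, `φ`, `ρ`,
`fC` are FREE symbols with defining hypotheses `hG` (px11's text VERBATIM), `hρ`, `hfC`; the rows are hypotheses in px11's ∕ B-β's texts.  THEOREMS ONLY (0 `def`, 0 `sorry`);
`--supports stmt-QuantumFields-19200 --as helper`, count-neutral.  YM₃ on T³ is a ladder rung (R3), not the Clay problem; nothing here claims `bern_P`, `hcoW`, E′, a stub, the crux,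
d = 4 or the mass gap.

WHAT IS PROVED (ns `…Theorems.Prop7TorusBlockFibres`; the energy theorem itself is ✓⧗ `Prop7CompetitorEnergyMember.competitor_energy_member`, next file).
* §1 `sum_pbond_filter` (bond fibres = site fibres × directions), `cellRepr_shift_apply_self ∕ _of_ne` (coordinates of `ρ(x + e_μ)`).
* §1b (block size `ℓ ∣ N`, `2ℓ ≤ N`): `blockMap_cellRepr_shift_of_emod_ne`, ★ `blockMap_cellRepr_shift_ne_of_emod_eq` (a boundary-layer step CHANGES the block, wrap-around included),
  ★ `bubble_cellRepr_shift_eq` (`φ(ρ(x+e_μ)) = φ(ρ x + e_μ)` for a bubble vanishing on the boundary layer), `mem_cell_of_mem_blockSites`, ★ `sum_fibre_eq_sum_blockSites`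
  (a cell-block fibre of the torus IS `blockSites ℓ y` through `ρ`∕`transl`), `card_fibre_eq` (`= ℓ^d`), `corner_mem_cell`, `cellRepr_cornerLabel`, `blockMap_cellRepr_cornerLabel`,
  ★ `cornerLabel_eq_iff` (same corner label ⟺ same block), `l1_sub_corner_le` (`≤ d·ℓ`).
(conjugation letters: lit ✓`B8Ineq132.norm_conjR_le`∕`conjR_conjR`, ✓`B9Eq332AvgCovariance.conjR_inv_conjR`, by name in the next file.)
HONEST SCOPE.  Bookkeeping + ✓ F1-core; no estimate of print; every analytic input is a displayed row supplied by px11 (F2b, (b-ℤ)) and B-β.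

References: T. Bałaban, CMP 96 (1984) 223–250 [Balaban1984PropagatorsII] (§1, (2.7)–(2.12)); CMP 99 (1985) 389–434 [Balaban1985BackgroundPropagators] ((3.18)–(3.23) pp.393–394);
CMP 98 (1985) 17–51 [Balaban1985Averaging] ((8)–(9) p.18, (78)–(87) pp.30–31); CMP 99 (1985) 75–102 [Balaban1985RegularSpaces] ((1.1) p.76).
-/

set_option autoImplicit false

noncomputable section

open scoped BigOperators Matrix.Norms.L2Operator
open Finset

namespace Summit.QuantumFields.YangMills.Theorems.Prop7TorusBlockFibres

open Literature.MathematicalPhysics.QuantumFieldTheory.Balaban1983to89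
open Literature.MathematicalPhysics.QuantumFieldTheory.Balaban1983to89.T3ContinuumYM3Torus
open B7Prop1Explicit renaming Site → LSite
open B7Prop1Explicit (e e_apply l1 U1 axialFn gaugeAct hol_mem)
open B7Eq78Linearization (conjR conjR_apply)
open B10Eq27TorusAxialLog (transl transl_apply transl_add_e pull pull_apply unitsField toUField)
open T3SectALandauChart (covDerivFwdT bgUnits eta eta_pos)
open B11Thm1LevelZero (unitsField_toUField_mem_U1)
open B8Eq143PlaqExpansion (norm_conjR_sub_self_le)
open Literature.MathematicalPhysics.QuantumLattice (blockMap blockBase blockSites mem_blockSites_iff card_blockSites)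
open Summit.QuantumFields.YangMills.Theorems.Prop7SPrint (basePt)
open Summit.QuantumFields.YangMills.Theorems.Prop7TorusCellRepr

/-! ## §1 Bookkeeping at the member -/

section Bookkeeping

variable {P : Params} {j : ℕ}

/-- bond fibres are site fibres times directions: `Σ_{b : p(b₋)} g b = Σ_{x : p x} Σ_μ g ⟨x, μ⟩`. [cite: Balaban1985Averaging, (5) p.18] -/
theorem sum_pbond_filter {M : Type*} [AddCommMonoid M] (p : Site P j → Prop) [DecidablePred p] (g : PBond P j → M) :
    ∑ b ∈ univ.filter (fun b : PBond P j => p b.src), g b = ∑ x ∈ univ.filter p, ∑ μ : Fin P.d, g ⟨x, μ⟩ := by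
  rw [sum_filter, B10StarCount.sum_pbond, sum_filter]
  refine sum_congr rfl fun x _ => ?_
  by_cases hx : p x
  · simp only [hx, if_true]
  · simp only [hx, if_false, sum_const_zero]

variable (y : Site P j) (ρ : Site P j → LSite P.d) (hρ : ∀ (x : Site P j) (ν : Fin P.d), ρ x ν = (((x ν - y ν).val : ℕ) : ℤ))
include hρ

/-- the `μ`-coordinate of `ρ(x + e_μ)` is `(ρ(x)_μ + 1) mod N`. [folklore] -/
theorem cellRepr_shift_apply_self (x : Site P j) (μ : Fin P.d) : ρ (x.shift μ) μ = (ρ x μ + 1) % (P.sitesPerDir j : ℤ) := by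
  rw [hρ, hρ, Site.shift, Function.update_self]
  have e1 : x μ + 1 - y μ = (x μ - y μ) + 1 := by ring
  rw [e1, ZMod.val_add, ZMod.val_one_eq_one_mod, Nat.add_mod_mod, Int.natCast_mod]
  push_cast
  rfl

/-- the other coordinates of `ρ(x + e_μ)` are those of `ρ(x)`. [folklore] -/
theorem cellRepr_shift_apply_of_ne (x : Site P j) {μ ν : Fin P.d} (h : ν ≠ μ) : ρ (x.shift μ) ν = ρ x ν := by
  rw [hρ, hρ, Site.shift, Function.update_of_ne h]

end Bookkeeping

/-! ## §1b Blocks of side `ℓ ∣ N` through the cell representative -/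

section Blocks

variable {P : Params} {j : ℕ} (y : Site P j) (ρ : Site P j → LSite P.d) (hρ : ∀ (x : Site P j) (ν : Fin P.d), ρ x ν = (((x ν - y ν).val : ℕ) : ℤ))
  {ℓ : ℕ} (hℓ : 0 < ℓ) (hdvd : ℓ ∣ P.sitesPerDir j) (h2ℓ : 2 * ℓ ≤ P.sitesPerDir j)
include hρ hℓ hdvd

/-- off the boundary layer a forward step keeps the block. [cite: Balaban1984PropagatorsII, (2.7)-(2.12) pp.224-225] -/
theorem blockMap_cellRepr_shift_of_emod_ne (x : Site P j) (μ : Fin P.d) (hne : ρ x μ % (ℓ : ℤ) ≠ (ℓ : ℤ) - 1) :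
    blockMap ℓ (ρ (x.shift μ)) = blockMap ℓ (ρ x) := by
  rw [cellRepr_shift_of_emod_ne y ρ hρ hℓ hdvd x μ hne]
  exact blockMap_add_e_eq_of_emod_ne hℓ (ρ x) μ hne

include h2ℓ in
/-- ★ on the boundary layer a forward step CHANGES the block (wrap-around included: the cell has at least two blocks per direction). [cite: Balaban1984PropagatorsII, (2.7)-(2.12) pp.224-225] -/
theorem blockMap_cellRepr_shift_ne_of_emod_eq (x : Site P j) (μ : Fin P.d) (heq : ρ x μ % (ℓ : ℤ) = (ℓ : ℤ) - 1) :
    blockMap ℓ (ρ (x.shift μ)) ≠ blockMap ℓ (ρ x) := by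
  intro h
  have hμ := congr_fun h μ
  simp only [blockMap] at hμ
  rw [cellRepr_shift_apply_self y ρ hρ x μ] at hμ
  have hℓZ : (0 : ℤ) < ℓ := by exact_mod_cast hℓ
  have hN : (0 : ℤ) < P.sitesPerDir j := by exact_mod_cast Nat.pos_of_ne_zero (NeZero.ne _)
  have ha0 := cellRepr_nonneg y ρ hρ x μ
  have haN := cellRepr_lt y ρ hρ x μ
  set a : ℤ := ρ x μ with ha
  -- `a = ℓq + (ℓ − 1)`
  have hdm := Int.emod_add_mul_ediv a (ℓ : ℤ)
  set q := a / (ℓ : ℤ) with hq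
  have haq : a + 1 = (ℓ : ℤ) * (q + 1) := by rw [heq] at hdm; linarith
  rcases lt_or_eq_of_le (Int.add_one_le_iff.mpr haN) with hlt | hwrap
  · -- no wrap: `(a+1)/ℓ = q + 1 ≠ q`
    rw [Int.emod_eq_of_lt (by linarith) hlt, haq, Int.mul_ediv_cancel_left _ hℓZ.ne'] at hμ
    linarith
  · -- wrap: `(a+1) % N = 0`, block `0`, but `q = N∕ℓ − 1 ≥ 1`
    rw [hwrap, Int.emod_self, Int.zero_ediv] at hμ
    obtain ⟨c, hc⟩ := hdvd
    have hNc : (P.sitesPerDir j : ℤ) = (ℓ : ℤ) * c := by exact_mod_cast hc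
    have hc2 : (2 : ℤ) ≤ c := by
      have : (2 : ℤ) * ℓ ≤ (ℓ : ℤ) * c := by rw [← hNc]; exact_mod_cast h2ℓ
      nlinarith
    have hq1 : q + 1 = c := by
      have : (ℓ : ℤ) * (q + 1) = (ℓ : ℤ) * c := by rw [← haq, hwrap, hNc]
      exact mul_left_cancel₀ hℓZ.ne' this
    linarith

omit hdvd in
/-- ★ the bubble read on `ρ(x + e_μ)` equals the bubble read on `ρ(x) + e_μ` — equal off the boundary layer, both zero on it (the bubble vanishes whenever a coordinate is `≡ 0` or
`≡ ℓ − 1 (mod ℓ)`). [cite: Balaban1984PropagatorsII, (2.7)-(2.12) pp.224-225] -/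
theorem bubble_cellRepr_shift_eq (hdvd : ℓ ∣ P.sitesPerDir j) (φ : LSite P.d → ℝ)
    (hφbd : ∀ (z : LSite P.d) (i : Fin P.d), (z i % (ℓ : ℤ) = 0 ∨ z i % (ℓ : ℤ) = (ℓ : ℤ) - 1) → φ z = 0)
    (x : Site P j) (μ : Fin P.d) : φ (ρ (x.shift μ)) = φ (ρ x + e μ) := by
  by_cases hne : ρ x μ % (ℓ : ℤ) ≠ (ℓ : ℤ) - 1
  · rw [cellRepr_shift_of_emod_ne y ρ hρ hℓ hdvd x μ hne]
  · rw [not_not] at hne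
    have h1 : φ (ρ x + e μ) = 0 := hφbd _ μ (Or.inl (emod_add_e_eq_zero_of_emod_eq_pred hℓ (ρ x) μ hne))
    have h2 : φ (ρ (x.shift μ)) = 0 := by
      refine hφbd _ μ (Or.inl ?_)
      rw [cellRepr_shift_apply_self y ρ hρ x μ, Int.emod_emod_of_dvd _ (by exact_mod_cast hdvd)]
      have := emod_add_e_eq_zero_of_emod_eq_pred hℓ (ρ x) μ hne
      rwa [add_e_apply_self] at this
    rw [h1, h2]

omit hℓ hdvd in
/-- the sites of a block whose label comes from a cell representative lie in the cell `[0, N)^d`. [folklore] -/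
theorem mem_cell_of_mem_blockSites (hℓ : 0 < ℓ) (hdvd : ℓ ∣ P.sitesPerDir j) (x₀ : Site P j) (z : LSite P.d) (hz : z ∈ blockSites ℓ (blockMap ℓ (ρ x₀))) (i : Fin P.d) :
    0 ≤ z i ∧ z i < P.sitesPerDir j := by
  haveI : NeZero ℓ := ⟨hℓ.ne'⟩
  have hzi := congr_fun ((mem_blockSites_iff ℓ _ z).1 hz) i
  simp only [blockMap] at hzi
  have hℓZ : (0 : ℤ) < ℓ := by exact_mod_cast hℓ
  have ha0 := cellRepr_nonneg y ρ hρ x₀ i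
  have haN := cellRepr_lt y ρ hρ x₀ i
  obtain ⟨c, hc⟩ := hdvd
  have hNc : (P.sitesPerDir j : ℤ) = (ℓ : ℤ) * c := by exact_mod_cast hc
  have hq0 : 0 ≤ ρ x₀ i / (ℓ : ℤ) := Int.ediv_nonneg ha0 hℓZ.le
  have hqc : ρ x₀ i / (ℓ : ℤ) < c := by
    rw [Int.ediv_lt_iff_lt_mul hℓZ]; rw [hNc] at haN; linarith
  constructor
  · by_contra hneg
    rw [not_le] at hneg
    have : z i / (ℓ : ℤ) < 0 := Int.ediv_neg_of_neg_of_pos hneg hℓZ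
    linarith
  · have h1 : z i < (ℓ : ℤ) * (z i / (ℓ : ℤ) + 1) := by
      have := Int.lt_mul_ediv_self_add (x := z i) hℓZ
      linarith
    have h2 : z i / (ℓ : ℤ) + 1 ≤ c := by rw [hzi]; omega
    calc z i < (ℓ : ℤ) * (z i / (ℓ : ℤ) + 1) := h1
      _ ≤ (ℓ : ℤ) * c := by gcongr
      _ = P.sitesPerDir j := hNc.symm

omit hℓ hdvd in
/-- ★ **A CELL-BLOCK FIBRE OF THE TORUS IS `blockSites ℓ y` THROUGH `ρ` ∕ `transl`**: `Σ_{x : block(ρ x) = block(ρ x₀)} g x = Σ_{z ∈ blockSites ℓ (block(ρ x₀))} g (y + z)`.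
[cite: Balaban1985BackgroundPropagators, (3.18) p.393] -/
theorem sum_fibre_eq_sum_blockSites (hℓ : 0 < ℓ) (hdvd : ℓ ∣ P.sitesPerDir j) {M : Type*} [AddCommMonoid M] (g : Site P j → M) (x₀ : Site P j) :
    ∑ x ∈ univ.filter (fun x => blockMap ℓ (ρ x) = blockMap ℓ (ρ x₀)), g x = ∑ z ∈ blockSites ℓ (blockMap ℓ (ρ x₀)), g (transl y z) := by
  haveI : NeZero ℓ := ⟨hℓ.ne'⟩
  refine sum_nbij' ρ (transl y) ?_ ?_ ?_ ?_ ?_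
  · intro x hx
    exact (mem_blockSites_iff ℓ _ _).2 (mem_filter.1 hx).2
  · intro z hz
    refine mem_filter.2 ⟨mem_univ _, ?_⟩
    rw [cellRepr_transl_of_mem_cell y ρ hρ z (mem_cell_of_mem_blockSites y ρ hρ hℓ hdvd x₀ z hz)]
    exact (mem_blockSites_iff ℓ _ _).1 hz
  · intro x _; exact transl_cellRepr y ρ hρ x
  · intro z hz; exact cellRepr_transl_of_mem_cell y ρ hρ z (mem_cell_of_mem_blockSites y ρ hρ hℓ hdvd x₀ z hz)
  · intro x _; rw [transl_cellRepr y ρ hρ x]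

omit hℓ hdvd in
/-- the fibre has `ℓ^d` sites. [cite: Balaban1985BackgroundPropagators, (3.18) p.393] -/
theorem card_fibre_eq (hℓ : 0 < ℓ) (hdvd : ℓ ∣ P.sitesPerDir j) (x₀ : Site P j) :
    ((univ.filter (fun x => blockMap ℓ (ρ x) = blockMap ℓ (ρ x₀))).card : ℝ) = (ℓ : ℝ) ^ P.d := by
  have h := sum_fibre_eq_sum_blockSites y ρ hρ hℓ hdvd (fun _ => (1 : ℝ)) x₀
  rw [sum_const, sum_const, card_blockSites, nsmul_eq_mul, nsmul_eq_mul, mul_one, mul_one] at h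
  rw [h]; push_cast; rfl

omit hℓ hdvd in
/-- the corner `ℓ·block(ρ x)` lies in the cell. [folklore] -/
theorem corner_mem_cell (hℓ : 0 < ℓ) (x : Site P j) (i : Fin P.d) :
    0 ≤ ((ℓ : ℤ) • blockMap ℓ (ρ x)) i ∧ ((ℓ : ℤ) • blockMap ℓ (ρ x)) i < P.sitesPerDir j := by
  have hℓZ : (0 : ℤ) < ℓ := by exact_mod_cast hℓ
  have ha0 := cellRepr_nonneg y ρ hρ x i
  have haN := cellRepr_lt y ρ hρ x i
  simp only [Pi.smul_apply, smul_eq_mul, blockMap]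
  constructor
  · exact mul_nonneg hℓZ.le (Int.ediv_nonneg ha0 hℓZ.le)
  · exact lt_of_le_of_lt (Int.mul_ediv_self_le hℓZ.ne') haN

omit hℓ hdvd in
/-- `ρ` of the corner label is the corner. [folklore] -/
theorem cellRepr_cornerLabel (hℓ : 0 < ℓ) (x : Site P j) : ρ (transl y ((ℓ : ℤ) • blockMap ℓ (ρ x))) = (ℓ : ℤ) • blockMap ℓ (ρ x) :=
  cellRepr_transl_of_mem_cell y ρ hρ _ (corner_mem_cell y ρ hρ hℓ x)

omit hℓ hdvd in
/-- the block of the corner label is the block. [folklore] -/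
theorem blockMap_cellRepr_cornerLabel (hℓ : 0 < ℓ) (x : Site P j) : blockMap ℓ (ρ (transl y ((ℓ : ℤ) • blockMap ℓ (ρ x)))) = blockMap ℓ (ρ x) := by
  haveI : NeZero ℓ := ⟨hℓ.ne'⟩
  rw [cellRepr_cornerLabel y ρ hρ hℓ x]
  have : (ℓ : ℤ) • blockMap ℓ (ρ x) = blockBase ℓ (blockMap ℓ (ρ x)) := by
    funext i; simp [blockBase]
  rw [this, Literature.MathematicalPhysics.QuantumLattice.blockMap_blockBase]

omit hℓ hdvd in
/-- ★ two sites have the same corner label iff they lie in the same block. [folklore] -/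
theorem cornerLabel_eq_iff (hℓ : 0 < ℓ) (x x' : Site P j) :
    transl y ((ℓ : ℤ) • blockMap ℓ (ρ x)) = transl y ((ℓ : ℤ) • blockMap ℓ (ρ x')) ↔ blockMap ℓ (ρ x) = blockMap ℓ (ρ x') := by
  constructor
  · intro h
    have := congrArg (fun s => blockMap ℓ (ρ s)) h
    rwa [blockMap_cellRepr_cornerLabel y ρ hρ hℓ, blockMap_cellRepr_cornerLabel y ρ hρ hℓ] at this
  · intro h; rw [h]

omit hρ hℓ hdvd in
/-- inside its block, a cell representative is within `ℓ¹`-distance `d·ℓ` of the corner. [folklore] -/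
theorem l1_sub_corner_le (hℓ : 0 < ℓ) (x : Site P j) : (l1 (ρ x - (ℓ : ℤ) • blockMap ℓ (ρ x)) : ℝ) ≤ (P.d : ℝ) * ℓ := by
  have hℓZ : (0 : ℤ) < ℓ := by exact_mod_cast hℓ
  have hpt : ∀ i, ((ρ x - (ℓ : ℤ) • blockMap ℓ (ρ x)) i).natAbs ≤ ℓ := by
    intro i
    simp only [Pi.sub_apply, Pi.smul_apply, smul_eq_mul, blockMap]
    have h0 : 0 ≤ ρ x i - (ℓ : ℤ) * (ρ x i / (ℓ : ℤ)) := by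
      have := Int.mul_ediv_self_le (x := ρ x i) hℓZ.ne'; linarith
    have h1 : ρ x i - (ℓ : ℤ) * (ρ x i / (ℓ : ℤ)) < ℓ := by
      have := Int.lt_mul_ediv_self_add (x := ρ x i) hℓZ; linarith
    have : ((ρ x i - (ℓ : ℤ) * (ρ x i / (ℓ : ℤ))).natAbs : ℤ) ≤ ℓ := by
      rw [Int.natAbs_of_nonneg h0]; exact h1.le
    exact_mod_cast this
  unfold l1
  calc ((∑ κ, ((ρ x - (ℓ : ℤ) • blockMap ℓ (ρ x)) κ).natAbs : ℕ) : ℝ) = ∑ κ, ((((ρ x - (ℓ : ℤ) • blockMap ℓ (ρ x)) κ).natAbs : ℕ) : ℝ) := by push_cast; rfl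
    _ ≤ ∑ _κ : Fin P.d, (ℓ : ℝ) := sum_le_sum fun i _ => by exact_mod_cast hpt i
    _ = (P.d : ℝ) * ℓ := by rw [sum_const, card_univ, Fintype.card_fin, nsmul_eq_mul]

end Blocks


end Summit.QuantumFields.YangMills.Theorems.Prop7TorusBlockFibres

end
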